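import Summits.Ventures.Crystal3D.Theorems.StickyWulffConstantCoaxialWallLawEndRowRatNarrow
import Summits.Ventures.Crystal3D.Theorems.StickyWulffConstantCoaxialWallLawEndRowDefsA
import HarnessLib

/-!
# Kernel certificate `endRowTransA_v2_ge`: `EndRowTransA WordVersion.v2 s_F → 1783/420 ≤ s_F`

HONEST FRAMING. Venture `Summits/Ventures/Crystal3D` (cell `crystal3d-full`), helper `--supports` the crux `CoaxialWallLaw`
(stmt-Ventures-19481, `route-Ventures-StickyWulffConstant`, REGISTERED line `WallLedgerF`, open stub `stub_coaxialTwoSlabAdhesion`).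
Seat 19481-p1 gen 12 (adversarial census ADV-ROW, memo HOME/wall-19481-p1/g12/F-ADVROW-g12.md).  A LOWER BOUND on any constant of
the census Prop `EndRowTransA WordVersion.v2` (`…CoaxialWallLawEndRowDefsA`, clause (A): the mover's predecessor ball `q − d ∈ X`), by an explicit finite configuration evaluated in the integer /
rational frame model of `…EndRowIntModel`, `…EndRowIntReadings`, `…EndRowRatFrames`, `…EndRowRatMoves`, `…EndRowRatNarrow`
(straight moves from FULL / GLIDING / NARROW predecessors at depth 0 and depth 1, CROSS moves).  Witness (cubic `√18`-integer
coordinates after normalising the reading frame to the base frame `L`): `174` sites, payer `zC`, `8` end balls, `30` exhibited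
end pairs; exhibited value `1783/420 = 4.245238` (`2√6 = 4.898979…`).  COMPUTATIONAL GRADE: one `native_decide` (`factsC`).
THE (A)-ROW OF RECORD (cf-p1 DECISIONS (xliii)/(xliii′), 19481-p2 p666610 `…EndRowDefsA`): this file is the KERNEL FLOOR
`endRowTransA_v2_ge : EndRowTransA WordVersion.v2 s_F → 1783/420 ≤ s_F` (= 4.245238…; the certificate constant of record is
s_F* = 9/2, margin 0.2548).  PHYSICAL WITNESS (driver coordinates, memo §2.7): the coherent Σ3 twin, COMPOSITION layer (jv = 0),
the √7 EQUILATERAL VACANCY TRIANGLE {(0,0,0), (−5,−3,0), (−1,−9,0)}, payer (−2,−6,0), inclined reading C6.p1 — lit g16's G3 /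
STEP-2 argmax (1783/420, kr, lineage 1) = cf-p2 §50.G3 (lineage 2) = this seat's (A)-driver: three lineages agree, and this file
makes it a kernel fact.  Every exhibited pair is a STRAIGHT move (kinds full0 / full1 / glide0 / narrow0 / narrow1) whose mover
has its predecessor ball (`predQ`, clause (A)) — checked inside the one `native_decide`.  It is also PREREG-F-CERT's STEP-0 anchor.
WHAT THIS IS NOT: no claim about the physical wall law or the crux; F-C1 not moved.
-/

noncomputable section

namespace Summit.Ventures.Crystal3D.Theorems

open Summit.Ventures.Crystal3D Finset NearIdentity
open Literature.MathematicalPhysics.StatisticalMechanics (barlowPos fccStacking constHagg)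
open scoped InnerProductSpace

namespace EndRowFloor

namespace CertA1783

/-- Clause (A) read in a rational frame `g`: the mover's predecessor site `q − τ•g i` is occupied. -/
def predQ (g : Fin 12 → Fin 3 → ℚ) (T : Finset (Fin 3 → ℚ)) (q : Fin 3 → ℚ) (i : Fin 12) (τ : ℤ) : Bool :=
  decide (q - (τ : ℚ) • g i ∈ T)

/-- Bridge for clause (A): the Bool fact gives the typed clause `PQ q − τ•Φ(sᵢ) ∈ X`. -/
theorem pred_of (F : RatFrame) {{S : Finset (Fin 3 → ℤ)}} {{q : Fin 3 → ℚ}} {{i : Fin 12}} {{τ : ℤ}}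
    (h : predQ F.g (SQ S) q i τ = true) : PQ q - (τ : ℝ) • F.Φ (slotSite i) ∈ Xof S := by
  unfold predQ at h
  rw [decide_eq_true_eq] at h
  have e := PQ_add_smul_slot F q i (-τ)
  have e1 : q + ((-τ : ℤ) : ℚ) • F.g i = q - (τ : ℚ) • F.g i := by push_cast; rw [neg_smul, sub_eq_add_neg]
  have e2 : PQ q + ((-τ : ℤ) : ℝ) • F.Φ (slotSite i) = PQ q - (τ : ℝ) • F.Φ (slotSite i) := by
    push_cast; rw [neg_smul, sub_eq_add_neg]
  rw [e1, e2] at e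
  rw [e, mem_Xof_Q]; exact h

/-- Integer triples as model vectors. -/
def toV (p : ℤ × ℤ × ℤ) : Fin 3 → ℤ := ![p.1, p.2.1, p.2.2]

set_option maxHeartbeats 2000000 in
/-- The raw site list of the witness. -/
def rawC : List (ℤ × ℤ × ℤ) :=
  [(-18, -3, -3), (-17, -10, -5), (-17, -7, -2), (-17, -4, 1), (-17, -1, 4), (-16, -11, -1), (-16, -8, 2), (-16, -5, 5), (-15, -15, 0), (-15, -12, 3), (-15, -9, 6), (-15, -6, -9), (-15, -6, 9), (-15, -3, -6), (-15, 0, -3), (-15, 3, 0), (-14, -10, -8), (-14, -7, -5), (-14, -4, -2), (-14, -1, 1), (-14, 2, 4), (-13, -14, -7), (-13, -11, -4), (-13, -8, -1), (-13, -5, 2), (-13, -2, 5), (-13, 1, 8), (-12, -15, -3), (-12, -15, 3), (-12, -12, 0), (-12, -12, 6), (-12, -9, 3), (-12, -9, 9), (-12, -6, 6), (-12, -3, -9), (-12, -3, 9), (-12, 0, -6), (-12, 3, -3), (-11, -10, -11), (-11, -7, -8), (-11, -4, -5), (-11, -1, -2), (-11, 2, 1), (-11, 5, 4), (-10, -11,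 -7), (-10, -8, -4), (-10, -5, -1), (-10, -2, 2), (-10, 1, 5), (-9, -18, -3), (-9, -18, 3), (-9, -15, -6), (-9, -15, 0), (-9, -15, 6), (-9, -12, -3), (-9, -12, 3), (-9, -12, 9), (-9, -9, 0), (-9, -9, 6), (-9, -9, 12), (-9, -6, 3), (-9, -6, 9), (-9, -3, -12), (-9, -3, 12), (-9, 0, -9), (-9, 0, 9), (-9, 3, -6), (-9, 6, -3), (-8, -7, -11), (-8, -4, -8), (-8, -1, -5), (-8, 2, -2), (-8, 5, 1), (-7, -11, -10), (-7, -8, -7), (-7, -5, -4), (-7, -2, -1), (-7, 1, 2), (-7, 4, 5), (-6, -18, 0), (-6, -15, -9), (-6, -15, -3), (-6, -15, 3), (-6, -15, 9), (-6, -12, -6), (-6, -12, 0), (-6, -12, 6), (-6, -9, 3), (-6, -9, 9), (-6, -6, 0), (-6, -6, 6), (-6, -6, 12), (-6, -3, 3), (-6, -3, 9), (-6, 0, 6), (-6, 3, -9), (-6, 3, 9), (-5, -4, -11), (-5, -1, -8), (-5, 2, -5), (-5, 5, -2), (-4, -8, -10), (-4, -5, -7), (-4, -2, -4), (-4, 1,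 -1), (-4, 4, 2), (-3, -18, -3), (-3, -18, 3), (-3, -15, -6), (-3, -15, 0), (-3, -15, 6), (-3, -12, -9), (-3, -12, -3), (-3, -12, 3), (-3, -12, 9), (-3, -9, -6), (-3, -9, 0), (-3, -9, 6), (-3, -9, 12), (-3, -6, -3), (-3, -6, 3), (-3, -6, 9), (-3, -3, 0), (-3, -3, 6), (-3, -3, 12), (-3, 0, 3), (-3, 0, 9), (-3, 3, 6), (-2, -1, -11), (-2, 2, -8), (-2, 5, -5), (-1, -5, -10), (-1, -2, -7), (-1, 1, -4), (-1, 4, -1), (0, -15, -3), (0, -15, 3), (0, -12, -6), (0, -12, 0), (0, -12, 6), (0, -9, -9), (0, -9, -3), (0, -9, 3), (0, -9, 9), (0, -6, -6), (0, -6, 0), (0, -6, 6), (0, -3, -3), (0, -3, 3), (0, -3, 9), (0, 0, 6), (0, 3, 3), (2, 1, -7), (3, -15, 0), (3, -12, -3), (3, -12, 3), (3, -9, -6), (3, -9, 0), (3, -9, 6), (3, -6, -9), (3, -6, -3), (3, -6, 3), (3, -6, 9), (3, -3, -6), (3, -3, 0), (3, -3, 6), (3, 0, -3), (3, 0, 3),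 (3, 3, 0), (6, -9, -3), (6, -9, 3), (6, -6, 0), (6, -3, -3), (6, -3, 3)]

/-- The site set of the witness. -/
def SC : Finset (Fin 3 → ℤ) := (rawC.map toV).toFinset

/-- The payer. -/
def zC : Fin 3 → ℤ := ![-6, -6, 0]

/-- The end balls pooled at the payer. -/
def bC : Fin 8 → (Fin 3 → ℤ) := ![![-6, -6, 0], ![-9, -9, 0], ![-9, -6, 3], ![-3, -6, -3], ![-7, -5, -4], ![-3, -9, 0], ![-6, -3, 3], ![-3, -3, 0]]

/-- The exhibited end pairs `(end ball, kind, direction slot, crossing/normal index, letter, predecessor)`; kinds: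
`0/1/2` = straight FULL / GLIDE / NARROW predecessor at depth 0 (`τ = 1`), `3/4/5` = the same at depth 1 (frame reflected across
the letter `cubeInt c₀`, `τ = −1`), `6` = CROSS of a depth-0 class, `7` = CROSS of a depth-1 class. -/
def prsC : List (Fin 8 × Fin 8 × Fin 12 × Fin 8 × Fin 8 × (Fin 3 → ℤ)) :=
  [(0, 3, 4, 0, 2, ![-7, -2, -1]),
   (0, 0, 7, 0, 0, ![-3, -6, 3]),
   (0, 0, 9, 0, 0, ![-6, -9, 3]),
   (0, 3, 10, 0, 2, ![-10, -5, -1]),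
   (1, 3, 4, 0, 2, ![-10, -5, -1]),
   (1, 0, 7, 0, 0, ![-6, -9, 3]),
   (1, 0, 9, 0, 0, ![-9, -12, 3]),
   (1, 3, 10, 0, 2, ![-13, -8, -1]),
   (2, 1, 0, 5, 0, ![-12, -9, 3]),
   (2, 5, 4, 7, 2, ![-10, -2, 2]),
   (2, 2, 7, 7, 0, ![-6, -6, 6]),
   (2, 0, 9, 0, 0, ![-9, -9, 6]),
   (2, 3, 10, 0, 2, ![-13, -5, 2]),
   (3, 2, 3, 6, 0, ![0, -3, -3]),
   (3, 3, 4, 0, 2, ![-4, -2, -4]),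
   (3, 0, 7, 0, 0, ![0, -6, 0]),
   (3, 2, 9, 1, 0, ![-3, -9, 0]),
   (3, 5, 10, 1, 2, ![-7, -5, -4]),
   (4, 3, 4, 0, 2, ![-8, -1, -5]),
   (5, 0, 7, 0, 0, ![0, -9, 3]),
   (6, 2, 3, 6, 0, ![-3, 0, 3]),
   (6, 3, 4, 0, 2, ![-7, 1, 2]),
   (6, 0, 7, 0, 0, ![-3, -3, 6]),
   (6, 2, 9, 1, 0, ![-6, -6, 6]),
   (6, 5, 10, 1, 2, ![-10, -2, 2]),
   (7, 2, 0, 0, 0, ![-6, -6, 0]),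
   (7, 5, 4, 7, 2, ![-4, 1, -1]),
   (7, 2, 7, 7, 0, ![0, -3, 3]),
   (7, 0, 9, 0, 0, ![-3, -6, 3]),
   (7, 3, 10, 0, 2, ![-7, -2, -1])]

/-- The exhibited predecessors of the end ball `j`. -/
def QsC (j : Fin 8) : Finset (Fin 3 → ℤ) := ((prsC.filter fun e => e.1 = j).map fun e => e.2.2.2.2.2).toFinset

/-- Slot / menu tables of the frames involved. -/
def g1 (c : Fin 8) : Fin 12 → (Fin 3 → ℚ) := gR (wBase c) gBase
/-- See `g1`. -/
def w1 (c : Fin 8) : Fin 8 → (Fin 3 → ℚ) := wR (wBase c) wBase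
/-- See `g1`. -/
def g2 (c₀ c : Fin 8) : Fin 12 → (Fin 3 → ℚ) := gR (w1 c₀ c) (g1 c₀)
/-- See `g1`. -/
def w2 (c₀ c : Fin 8) : Fin 8 → (Fin 3 → ℚ) := wR (w1 c₀ c) (w1 c₀)

/-- End-ball tests in a frame with tables `(g, w)` for direction `(i, τ)`. -/
def endOK (g : Fin 12 → (Fin 3 → ℚ)) (w : Fin 8 → (Fin 3 → ℚ)) (b : Fin 3 → ℤ) (i : Fin 12) (τ : ℤ) : Prop :=
  fullQ g (SQ SC) (castQ b) = false ∧ (∀ c' : Fin 8, twinFailQ g w (SQ SC) (castQ b) c' = true) ∧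
    narrowFailQ g (SQ SC) (castQ b) i τ = true

/-- Kind 0: straight from a FULL predecessor at depth 0. -/
def K0 (j : Fin 8) (i : Fin 12) (q : Fin 3 → ℤ) : Prop :=
  predQ gBase (SQ SC) (castQ q) i 1 = true ∧ castQ (bC j) = castQ q + (1 : ℚ) • gBase i ∧ fullQ gBase (SQ SC) (castQ q) = true ∧ endOK gBase wBase (bC j) i 1
/-- Kind 1: straight from a GLIDING predecessor at depth 0. -/
def K1 (j : Fin 8) (i : Fin 12) (c : Fin 8) (q : Fin 3 → ℤ) : Prop :=
  predQ gBase (SQ SC) (castQ q) i 1 = true ∧ castQ (bC j) = castQ q + (1 : ℚ) • gBase i ∧ twinOKQ gBase wBase (SQ SC) (castQ q) c = true ∧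
    dz (slotInt i) (cubeInt c) = 0 ∧ endOK gBase wBase (bC j) i 1
/-- Kind 2: straight from a NARROW predecessor at depth 0. -/
def K2 (j : Fin 8) (i : Fin 12) (c : Fin 8) (q : Fin 3 → ℤ) : Prop :=
  predQ gBase (SQ SC) (castQ q) i 1 = true ∧ castQ (bC j) = castQ q + (1 : ℚ) • gBase i ∧ narrowOKQ gBase (SQ SC) (castQ q) i 1 c = true ∧ endOK gBase wBase (bC j) i 1
/-- Kind 3: straight from a FULL predecessor at depth 1. -/
def K3 (j : Fin 8) (i : Fin 12) (c₀ : Fin 8) (q : Fin 3 → ℤ) : Prop :=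
  predQ (g1 c₀) (SQ SC) (castQ q) i (-1) = true ∧ dz (slotInt i) (cubeInt c₀) = 2 ∧ castQ (bC j) = castQ q + ((-1 : ℤ) : ℚ) • g1 c₀ i ∧
    fullQ (g1 c₀) (SQ SC) (castQ q) = true ∧ endOK (g1 c₀) (w1 c₀) (bC j) i (-1)
/-- Kind 4: straight from a GLIDING predecessor at depth 1. -/
def K4 (j : Fin 8) (i : Fin 12) (c c₀ : Fin 8) (q : Fin 3 → ℤ) : Prop :=
  predQ (g1 c₀) (SQ SC) (castQ q) i (-1) = true ∧ dz (slotInt i) (cubeInt c₀) = 2 ∧ castQ (bC j) = castQ q + ((-1 : ℤ) : ℚ) • g1 c₀ i ∧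
    twinOKQ (g1 c₀) (w1 c₀) (SQ SC) (castQ q) c = true ∧ dz (slotInt i) (cubeInt c) = 0 ∧ endOK (g1 c₀) (w1 c₀) (bC j) i (-1)
/-- Kind 5: straight from a NARROW predecessor at depth 1. -/
def K5 (j : Fin 8) (i : Fin 12) (c c₀ : Fin 8) (q : Fin 3 → ℤ) : Prop :=
  predQ (g1 c₀) (SQ SC) (castQ q) i (-1) = true ∧ dz (slotInt i) (cubeInt c₀) = 2 ∧ castQ (bC j) = castQ q + ((-1 : ℤ) : ℚ) • g1 c₀ i ∧
    narrowOKQ (g1 c₀) (SQ SC) (castQ q) i (-1) c = true ∧ endOK (g1 c₀) (w1 c₀) (bC j) i (-1)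
/-- Kind 6: CROSS of a depth-0 class. -/
def K6 (j : Fin 8) (i : Fin 12) (c : Fin 8) (q : Fin 3 → ℤ) : Prop :=
  predQ gBase (SQ SC) (castQ q) i 1 = true ∧ (1 : ℤ) * dz (slotInt i) (cubeInt c) = 2 ∧ castQ (bC j) = castQ q - ((1 : ℤ) : ℚ) • mirQ gBase wBase i c ∧
    twinOKQ gBase wBase (SQ SC) (castQ q) c = true ∧ endOK (g1 c) (w1 c) (bC j) i (-1)
/-- Kind 7: CROSS of a depth-1 class. -/
def K7 (j : Fin 8) (i : Fin 12) (c c₀ : Fin 8) (q : Fin 3 → ℤ) : Prop :=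
  predQ (g1 c₀) (SQ SC) (castQ q) i (-1) = true ∧ dz (slotInt i) (cubeInt c₀) = 2 ∧ (-1 : ℤ) * dz (slotInt i) (cubeInt c) = 2 ∧
    castQ (bC j) = castQ q - ((-1 : ℤ) : ℚ) • mirQ (g1 c₀) (w1 c₀) i c ∧
    twinOKQ (g1 c₀) (w1 c₀) (SQ SC) (castQ q) c = true ∧ endOK (g2 c₀ c) (w2 c₀ c) (bC j) i (- -1)

/-- Decidability of the end-ball tests. -/
instance instDecEndOK (g : Fin 12 → (Fin 3 → ℚ)) (w : Fin 8 → (Fin 3 → ℚ)) (b : Fin 3 → ℤ) (i : Fin 12) (τ : ℤ) :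
    Decidable (endOK g w b i τ) := by unfold endOK; infer_instance
/-- Decidability of the kind clauses. -/
instance instDecK0 (j i q) : Decidable (K0 j i q) := by unfold K0; infer_instance
/-- See `instDecK0`. -/
instance instDecK1 (j i c q) : Decidable (K1 j i c q) := by unfold K1; infer_instance
/-- See `instDecK0`. -/
instance instDecK2 (j i c q) : Decidable (K2 j i c q) := by unfold K2; infer_instance
/-- See `instDecK0`. -/
instance instDecK3 (j i c₀ q) : Decidable (K3 j i c₀ q) := by unfold K3; infer_instance
/-- See `instDecK0`. -/
instance instDecK4 (j i c c₀ q) : Decidable (K4 j i c c₀ q) := by unfold K4; infer_instance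
/-- See `instDecK0`. -/
instance instDecK5 (j i c c₀ q) : Decidable (K5 j i c c₀ q) := by unfold K5; infer_instance
/-- See `instDecK0`. -/
instance instDecK6 (j i c q) : Decidable (K6 j i c q) := by unfold K6; infer_instance
/-- See `instDecK0`. -/
instance instDecK7 (j i c c₀ q) : Decidable (K7 j i c c₀ q) := by unfold K7; infer_instance

/-- The per-pair certificate (decidable). -/
def PairOK (e : Fin 8 × Fin 8 × Fin 12 × Fin 8 × Fin 8 × (Fin 3 → ℤ)) : Prop :=
  e.2.2.2.2.2 ∈ SC ∧ (slotKIJ e.2.2.1).1 = 0 ∧ (-24 * slotInt e.2.2.1 0 - 7 * slotInt e.2.2.1 2 : ℤ) ≠ 0 ∧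
  (e.2.1 = 0 → K0 e.1 e.2.2.1 e.2.2.2.2.2) ∧ (e.2.1 = 1 → K1 e.1 e.2.2.1 e.2.2.2.1 e.2.2.2.2.2) ∧
  (e.2.1 = 2 → K2 e.1 e.2.2.1 e.2.2.2.1 e.2.2.2.2.2) ∧ (e.2.1 = 3 → K3 e.1 e.2.2.1 e.2.2.2.2.1 e.2.2.2.2.2) ∧
  (e.2.1 = 4 → K4 e.1 e.2.2.1 e.2.2.2.1 e.2.2.2.2.1 e.2.2.2.2.2) ∧ (e.2.1 = 5 → K5 e.1 e.2.2.1 e.2.2.2.1 e.2.2.2.2.1 e.2.2.2.2.2) ∧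
  (e.2.1 = 6 → K6 e.1 e.2.2.1 e.2.2.2.1 e.2.2.2.2.2) ∧ (e.2.1 = 7 → K7 e.1 e.2.2.1 e.2.2.2.1 e.2.2.2.2.1 e.2.2.2.2.2)

/-- Decidability of the per-pair certificate. -/
instance instDecPairOK (e : Fin 8 × Fin 8 × Fin 12 × Fin 8 × Fin 8 × (Fin 3 → ℤ)) : Decidable (PairOK e) := by
  unfold PairOK; infer_instance

/-- **All finite facts of the certificate, by evaluation** (`native_decide`). -/
theorem factsC :
    (∀ u ∈ SC, ∀ v ∈ SC, u ≠ v → 18 ≤ dz (u - v) (u - v)) ∧ zC ∈ SC ∧ degS SC zC ≤ 11 ∧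
    (∀ j j' : Fin 8, bC j = bC j' → j = j') ∧
    (∀ j : Fin 8, bC j ∈ SC ∧ degS SC (bC j) ≤ 11 ∧ dz (zC - bC j) (zC - bC j) ≤ 18 ∧ 0 < pooledS SC (bC j) ∧ 0 < (QsC j).card) ∧
    (∀ e ∈ prsC, PairOK e) ∧
    (∑ j : Fin 8, ((QsC j).card : ℚ) / (pooledS SC (bC j) : ℚ)) = 1783 / 420 := by
  native_decide


open scoped Classical in
/-- Exhibited (A)-end pairs bound the (A)-end multiplicity from below (any word version). -/
theorem le_endMultA_v {ver : WordVersion} {S : Finset (Fin 3 → ℤ)} (b : Fin 3 → ℤ) (Q : Finset (Fin 3 → ℤ))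
    (hQ : ∀ q ∈ Q, IsEndPairA (Xof S) ver S1 S2 (P b) (P q)) : Q.card ≤ endMultA (Xof S) ver S1 S2 (P b) := by
  unfold endMultA
  rw [← Finset.card_map Pemb]
  apply Finset.card_le_card
  intro x hx
  rw [Finset.mem_map] at hx
  obtain ⟨q, hq, rfl⟩ := hx
  rw [Finset.mem_filter]
  exact ⟨(hQ q hq).1, hQ q hq⟩

/-- Assembling an (A)-end pair (any word version). -/
theorem isEndPairA_gen_v {ver : WordVersion} {S : Finset (Fin 3 → ℤ)} {b q : Fin 3 → ℤ} (hq : q ∈ S) (hb : b ∈ S)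
    (hdeg : degS S b ≤ 11) (G : EuclideanSpace ℝ (Fin 3) ≃ₗᵢ[ℝ] EuclideanSpace ℝ (Fin 3)) (d : EuclideanSpace ℝ (Fin 3))
    (hadm : S1.Adm G d ∨ S2.Adm G d) (hpred : PQ (castQ q) - d ∈ Xof S)
    (hmove : IsEndMove (Xof S) ver G d (PQ (castQ q)) (PQ (castQ b))) :
    IsEndPairA (Xof S) ver S1 S2 (P b) (P q) := by
  refine ⟨mem_Xof.2 hq, mem_Xof.2 hb, hasTwoPayers_of_deg hdeg, G, d, hadm, ?_, ?_⟩
  · rw [P_eq_PQ]; exact hpred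
  · rw [P_eq_PQ, P_eq_PQ]; exact hmove

set_option maxRecDepth 8192 in
open scoped Classical in
/-- The exhibited end pairs are end pairs. -/
theorem card_QsC_le_endMult (j : Fin 8) : (QsC j).card ≤ endMultA (Xof SC) WordVersion.v2 S1 S2 (P (bC j)) := by
  have hF := factsC
  have hballs := hF.2.2.2.2.1
  have hpairs := hF.2.2.2.2.2.1
  have hbS : bC j ∈ SC := (hballs j).1
  have hbdeg : degS SC (bC j) ≤ 11 := (hballs j).2.1
  apply le_endMultA_v
  intro q hq
  rw [QsC, List.mem_toFinset, List.mem_map] at hq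
  obtain ⟨e, he, rfl⟩ := hq
  rw [List.mem_filter] at he
  obtain ⟨he, hej⟩ := he
  have hP := hpairs e he
  obtain ⟨j', k, i, c, c₀, q⟩ := e
  simp only [decide_eq_true_eq] at hej
  subst hej
  obtain ⟨hqS, hk, hN, h0, h1, h2, h3, h4, h5, h6, h7⟩ := hP
  have eB : RatFrame.base.Φ = L := rfl
  have eR1 : ∀ c₀ : Fin 8, (RatFrame.base.reflect c₀).g = g1 c₀ := fun _ => rfl
  have eW1 : ∀ c₀ : Fin 8, (RatFrame.base.reflect c₀).w = w1 c₀ := fun _ => rfl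
  fin_cases k
  · obtain ⟨hpd, hbq, hq', hb1, hb2, hb3⟩ := (h0 rfl : K0 _ _ _)
    refine isEndPairA_gen_v hqS hbS hbdeg L (L (slotSite i)) (adm_root_or hk hN) ?_ ?_
    · have hp := pred_of RatFrame.base hpd
      rw [eB, Int.cast_one, one_smul] at hp; exact hp
    have h := RatFrame.base.isEndMove_full_any (S := SC) WordVersion.v2 (castQ q) (castQ (bC j')) i 1 hbq hq' hb1 hb2 hb3
    rw [eB, Int.cast_one, one_smul] at h; exact h
  · obtain ⟨hpd, hbq, hq', hperp, hb1, hb2, hb3⟩ := (h1 rfl : K1 _ _ _ _)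
    refine isEndPairA_gen_v hqS hbS hbdeg L (L (slotSite i)) (adm_root_or hk hN) ?_ ?_
    · have hp := pred_of RatFrame.base hpd
      rw [eB, Int.cast_one, one_smul] at hp; exact hp
    have h := RatFrame.base.isEndMove_glide_any (S := SC) WordVersion.v2 (castQ q) (castQ (bC j')) i 1 c hbq hq' hperp hb1 hb2 hb3
    rw [eB, Int.cast_one, one_smul] at h; exact h
  · obtain ⟨hpd, hbq, hq', hb1, hb2, hb3⟩ := (h2 rfl : K2 _ _ _ _)
    refine isEndPairA_gen_v hqS hbS hbdeg L (L (slotSite i)) (adm_root_or hk hN) ?_ ?_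
    · have hp := pred_of RatFrame.base hpd
      rw [eB, Int.cast_one, one_smul] at hp; exact hp
    have h := RatFrame.base.isEndMove_narrow (S := SC) (castQ q) (castQ (bC j')) i 1 c hbq hq' hb1 hb2 hb3
    rw [eB, Int.cast_one, one_smul] at h; exact h
  · obtain ⟨hpd, hup0, hbq, hq', hb1, hb2, hb3⟩ := (h3 rfl : K3 _ _ _ _)
    refine isEndPairA_gen_v hqS hbS hbdeg (RatFrame.base.reflect c₀).Φ ((-1 : ℝ) • (RatFrame.base.reflect c₀).Φ (slotSite i))
      (adm_depth1_or hk hN c₀ hup0) ?_ ?_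
    · have hp := pred_of (RatFrame.base.reflect c₀) hpd
      simpa using hp
    have h := (RatFrame.base.reflect c₀).isEndMove_full_any (S := SC) WordVersion.v2 (castQ q) (castQ (bC j')) i (-1) hbq hq' hb1 hb2 hb3
    simpa using h
  · obtain ⟨hpd, hup0, hbq, hq', hperp, hb1, hb2, hb3⟩ := (h4 rfl : K4 _ _ _ _ _)
    refine isEndPairA_gen_v hqS hbS hbdeg (RatFrame.base.reflect c₀).Φ ((-1 : ℝ) • (RatFrame.base.reflect c₀).Φ (slotSite i))
      (adm_depth1_or hk hN c₀ hup0) ?_ ?_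
    · have hp := pred_of (RatFrame.base.reflect c₀) hpd
      simpa using hp
    have h := (RatFrame.base.reflect c₀).isEndMove_glide_any (S := SC) WordVersion.v2 (castQ q) (castQ (bC j')) i (-1) c hbq hq' hperp hb1 hb2 hb3
    simpa using h
  · obtain ⟨hpd, hup0, hbq, hq', hb1, hb2, hb3⟩ := (h5 rfl : K5 _ _ _ _ _)
    refine isEndPairA_gen_v hqS hbS hbdeg (RatFrame.base.reflect c₀).Φ ((-1 : ℝ) • (RatFrame.base.reflect c₀).Φ (slotSite i))
      (adm_depth1_or hk hN c₀ hup0) ?_ ?_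
    · have hp := pred_of (RatFrame.base.reflect c₀) hpd
      simpa using hp
    have h := (RatFrame.base.reflect c₀).isEndMove_narrow (S := SC) (castQ q) (castQ (bC j')) i (-1) c hbq hq' hb1 hb2 hb3
    simpa using h
  · obtain ⟨hpd, hup, hbq, hq', hb1, hb2, hb3⟩ := (h6 rfl : K6 _ _ _ _)
    refine isEndPairA_gen_v hqS hbS hbdeg L (L (slotSite i)) (adm_root_or hk hN) ?_ ?_
    · have hp := pred_of RatFrame.base hpd
      rw [eB, Int.cast_one, one_smul] at hp; exact hp
    have h := RatFrame.base.isEndMove_cross_any (S := SC) WordVersion.v2 (castQ q) (castQ (bC j')) i c 1 hup hbq hq' hb1 hb2 hb3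
    rw [eB, Int.cast_one, one_smul] at h; exact h
  · obtain ⟨hpd, hup0, hup1, hbq, hq', hb1, hb2, hb3⟩ := (h7 rfl : K7 _ _ _ _ _)
    refine isEndPairA_gen_v hqS hbS hbdeg (RatFrame.base.reflect c₀).Φ ((-1 : ℝ) • (RatFrame.base.reflect c₀).Φ (slotSite i))
      (adm_depth1_or hk hN c₀ hup0) ?_ ?_
    · have hp := pred_of (RatFrame.base.reflect c₀) hpd
      simpa using hp
    have h := (RatFrame.base.reflect c₀).isEndMove_cross_any (S := SC) WordVersion.v2 (castQ q) (castQ (bC j')) i c (-1) hup1 hbq hq' hb1 hb2 hb3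
    simpa using h


open scoped Classical in
/-- Row domination for the (A) row (copy of `sum_le_of_localEndRow'` for `LocalEndRowA`, any word version). -/
theorem sum_le_of_localEndRowA_v {ver : WordVersion} {S : Finset (Fin 3 → ℤ)}
    (hsep : ∀ u ∈ S, ∀ v ∈ S, u ≠ v → 18 ≤ dz (u - v) (u - v))
    {sF : ℝ} (hrow : LocalEndRowA ver sF S1 S2) (uz : Fin 3 → ℤ) (hz : uz ∈ S) (hzdeg : degS S uz ≤ 11)
    {ι : Type*} (B : Finset ι) (pt : ι → (Fin 3 → ℤ)) (hinj : Set.InjOn pt B) (m : ι → ℕ)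
    (hnear : ∀ j ∈ B, dz (uz - pt j) (uz - pt j) ≤ 18)
    (hm : ∀ j ∈ B, m j ≤ endMultA (Xof S) ver S1 S2 (P (pt j)))
    (hmpos : ∀ j ∈ B, 0 < m j) (hpool : ∀ j ∈ B, 0 < pooledS S (pt j)) :
    ∑ j ∈ B, (m j : ℝ) / (pooledS S (pt j) : ℝ) ≤ sF := by
  have hX := sep_Xof hsep
  have hzpay : ((Xof S).filter fun q => dist (P uz) q = 1).card ≤ 11 := by rw [card_contacts]; exact hzdeg
  have h := hrow (Xof S) hX (P uz) (mem_Xof.2 hz) hzpay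
  refine le_trans ?_ h
  have hinj' : Set.InjOn (fun j => P (pt j)) B := fun j hj j' hj' e => hinj hj hj' (P_injective e)
  have hsub : B.image (fun j => P (pt j)) ⊆
      (Xof S).filter (fun b => dist (P uz) b ≤ 1 ∧ 0 < endMultA (Xof S) ver S1 S2 b) := by
    intro x hx
    rw [Finset.mem_image] at hx
    obtain ⟨j, hj, rfl⟩ := hx
    rw [Finset.mem_filter]
    have hpos : 0 < endMultA (Xof S) ver S1 S2 (P (pt j)) := lt_of_lt_of_le (hmpos j hj) (hm j hj)
    have hbX : P (pt j) ∈ Xof S := by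
      have hpos' := hpos
      unfold endMultA at hpos'
      obtain ⟨q, hq⟩ := Finset.card_pos.1 hpos'
      rw [Finset.mem_filter] at hq
      exact hq.2.2.1
    exact ⟨hbX, (dist_P_le_one_iff uz (pt j)).2 (hnear j hj), hpos⟩
  calc ∑ j ∈ B, (m j : ℝ) / (pooledS S (pt j) : ℝ)
      ≤ ∑ j ∈ B, (endMultA (Xof S) ver S1 S2 (P (pt j)) : ℝ) / pooledDef (Xof S) (P (pt j)) := by
        apply Finset.sum_le_sum
        intro j hj
        rw [pooledDef_eq]
        exact div_le_div_of_nonneg_right (by exact_mod_cast hm j hj) (by exact_mod_cast (hpool j hj).le)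
    _ = ∑ x ∈ B.image (fun j => P (pt j)), (endMultA (Xof S) ver S1 S2 x : ℝ) / pooledDef (Xof S) x := by
        rw [Finset.sum_image hinj']
    _ ≤ _ := by
        apply Finset.sum_le_sum_of_subset_of_nonneg hsub
        intro x _ _
        exact div_nonneg (Nat.cast_nonneg _) (pooledDef_nonneg _ _)

end CertA1783

end EndRowFloor

set_option maxRecDepth 8192 in
open EndRowFloor EndRowFloor.CertA1783 in
/-- **`EndRowTransA WordVersion.v2 s_F` forces `s_F ≥ 1783/420 = 4.2452`.** -/
theorem endRowTransA_v2_ge {sF : ℝ} (h : EndRowTransA WordVersion.v2 sF) : (1783 : ℝ) / 420 ≤ sF := by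
  have hF := factsC
  have hsep := hF.1
  have hz := hF.2.1
  have hzdeg := hF.2.2.1
  have hinj := hF.2.2.2.1
  have hballs := hF.2.2.2.2.1
  have hkey := hF.2.2.2.2.2.2
  have hrow : LocalEndRowA WordVersion.v2 sF S1 S2 := h L
  have hsum := sum_le_of_localEndRowA_v hsep hrow zC hz hzdeg (Finset.univ : Finset (Fin 8)) bC
    (fun j _ j' _ e => hinj j j' e) (fun j => (QsC j).card)
    (fun j _ => (hballs j).2.2.1) (fun j _ => card_QsC_le_endMult j) (fun j _ => (hballs j).2.2.2.2)
    (fun j _ => (hballs j).2.2.2.1)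
  have hcast : ∑ j : Fin 8, (((QsC j).card : ℕ) : ℝ) / (pooledS SC (bC j) : ℝ) =
      ((∑ j : Fin 8, ((QsC j).card : ℚ) / (pooledS SC (bC j) : ℚ) : ℚ) : ℝ) := by
    push_cast; rfl
  rw [hcast, hkey] at hsum
  have : (((1783 : ℚ) / 420 : ℚ) : ℝ) = (1783 : ℝ) / 420 := by push_cast; rfl
  linarith [this]

end Summit.Ventures.Crystal3D.Theorems

end
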